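import Summits.BirchSwinnertonDyer.BirchSwinnertonDyer.Theorems.ClassRecordThreeRegCertKernelLog
import HarnessLib

/-!
# Route `ClassRecordThree`, crux `SchneiderAtThree` (item 19106): the kernel evaluator for the Stein–Wuthrich §4.2
# height at a DEEP certificate point (`v₃(e(Q)) = K ≥ 2`) — `heightFourOneCoord W 3 q x y ≠ 0` from `9 ∤ b⁴ − a⁴`
# (cell `bsd-stepL`, seat `bsd-stepL-reg3-eng` g3; `--supports stmt-BirchSwinnertonDyer-19106`)

HONEST FRAMING: BSD is not proved by any of this; nothing here closes the crux; Schneider's conjecture (barrier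
`PAdicHeightNondegeneracy`) is asserted NOWHERE. Companion of `…RegCertKernelLog` / `…RegCertKernelHeight` (the case
`v₃(e(Q)) = 1`). When the certificate point `Q = (a/e², b/e³)` of a REG3CERT row has `e = 3^K e'`, `K ≥ 2` (130 of the
723 TRUE-OPEN non-split (ram) X11b@3 rows), the first-order evaluation of `h` collapses (`z = −ae/b`, `‖z‖ = 3⁻ᴷ`):
§1 `‖log_Ŵ(z) − z‖ ≤ ‖z‖²` on `‖z‖ ≤ 3⁻²`; §2 `‖ch(w) − 1 − w/2‖ ≤ 3‖w‖²` on `‖w‖ ≤ 3⁻⁴`; §3 the Iwasawa logarithm at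
valuation `2K` to first order; §4 **`heightFourOneCoord_ne_zero_of_deepCert`**: `C²σ² ≡ log_Ŵ(z)² ≡ z² = 3^{2K}(ae'/b)²`
to relative precision `3⁻²` (the scale `C²` CANCELS at this depth), so `h ≡ e'⁴(b⁴ − a⁴)/(2b⁴) (mod 9)` and the single
decidable condition **`9 ∤ b⁴ − a⁴`** gives `h ≠ 0` for EVERY `‖q‖₃ < 1`. Validated offline on 124/124 such rows of
kit j249075. Theorems only (0 defs, 0 facts). References: [SteinWuthrich2013] §4.2; [SilvermanAEC2009] IV.6.3–6.4;
[Iwasawa1972PadicL] §4.4.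
-/

open scoped Classical

open PowerSeries WeierstrassCurve Literature.NumberTheory.EllipticCurves
  Literature.NumberTheory.EllipticCurves.SteinWuthrich2013
  Summit.BirchSwinnertonDyer.Rank1Residual.X11b.RegMult.Rung62310y1

namespace Summit.BirchSwinnertonDyer.Rank1Residual.X11b.RegMult.KernelCert

/-! ### §0 Plumbing -/

/-- Ultrametric inequality for differences. [folklore] -/
private theorem norm_sub_le_max₂ (a b : ℚ_[3]) : ‖a - b‖ ≤ max ‖a‖ ‖b‖ := by
  rw [sub_eq_add_neg, ← norm_neg b]; exact IsUltrametricDist.norm_add_le_max a (-b)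

/-- `‖(2 : ℚ₃)⁻¹‖ = 1`. [folklore] -/
private theorem norm_inv_two₂ : ‖(2 : ℚ_[3])⁻¹‖ = 1 := by
  rw [norm_inv, show (2 : ℚ_[3]) = ((2 : ℤ) : ℚ_[3]) by norm_cast, norm_intCast_eq_one_of_not_dvd (by decide),
    inv_one]

/-- `n + 4 ≤ 9^{n+2}`. [folklore] -/
private theorem add_four_le_nine_pow (n : ℕ) : n + 4 ≤ 9 ^ (n + 2) := by
  induction n with
  | zero => norm_num
  | succ k ih =>
    have h : 9 ^ (k + 1 + 2) = 9 * 9 ^ (k + 2) := by ring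
    omega

/-- **Legendre at `p = 3`**: `‖1/(2n)!‖₃ ≤ 3ⁿ`. [Silverman AEC IV.6.3(a)] [folklore] -/
private theorem norm_inv_factorial_le' (n : ℕ) : ‖(((2 * n).factorial : ℕ) : ℚ_[3])⁻¹‖ ≤ (3 : ℝ) ^ n := by
  have hf : ((2 * n).factorial : ℕ) ≠ 0 := Nat.factorial_ne_zero _
  rw [norm_inv, Padic.norm_eq_zpow_neg_valuation (by exact_mod_cast hf), Padic.valuation_natCast, zpow_neg,
    inv_inv, zpow_natCast]
  have hv : padicValNat 3 (2 * n).factorial ≤ n := by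
    have h := sub_one_mul_padicValNat_factorial (p := 3) (2 * n)
    have hs : (3 - 1) * padicValNat 3 (2 * n).factorial ≤ 2 * n := by rw [h]; exact Nat.sub_le _ _
    omega
  exact_mod_cast Nat.pow_le_pow_right (by norm_num) hv

/-- `3 ∤ n ⇒ 3 ∣ n⁴ − 1`. [folklore] -/
private theorem three_dvd_pow_four_sub_one {n : ℤ} (h : ¬ (3 : ℤ) ∣ n) : (3 : ℤ) ∣ n ^ 4 - 1 := by
  have key : ∀ x : ZMod 3, x ≠ 0 → x ^ 4 - 1 = 0 := by decide
  have hx : ((n : ZMod 3)) ≠ 0 := by rw [Ne, ZMod.intCast_zmod_eq_zero_iff_dvd]; exact_mod_cast h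
  have h2 : (((n ^ 4 - 1 : ℤ)) : ZMod 3) = 0 := by push_cast; exact key _ hx
  exact_mod_cast (ZMod.intCast_zmod_eq_zero_iff_dvd _ 3).mp h2

/-! ### §1 The formal logarithm to first order: `‖log_Ŵ(z) − z‖ ≤ ‖z‖²` on `‖z‖ ≤ 3⁻²` -/

section Padic

variable (V : WeierstrassCurve ℚ_[3]) [V.IsIntegral ℤ_[3]]

/-- Each term of degree `n + 2` of `log_Ŵ(z)` has norm `≤ ‖z‖²` when `‖z‖₃ ≤ 3⁻²` (`‖1/2‖ = 1`, `‖1/3‖·‖z‖ ≤ 1`,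
`‖1/m‖ ≤ m ≤ 9^{m−2}` for `m ≥ 4`). [Silverman AEC IV.6.3] [cite: SilvermanAEC2009, IV.6.3] -/
private theorem norm_formalLog_term_le_sq {z : ℚ_[3]} (hz : ‖z‖ ≤ 1 / 9) (n : ℕ) :
    ‖coeff (n + 2) V.formalLog * z ^ (n + 2)‖ ≤ ‖z‖ ^ 2 := by
  rw [norm_mul, norm_pow]
  have hc := norm_coeff_formalLog_le_norm_inv V n
  have hz0 : 0 ≤ ‖z‖ := norm_nonneg z
  rcases Nat.lt_or_ge n 2 with hn | hn
  · interval_cases n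
    · -- `n + 2 = 2`
      have h2 : ‖(((0 + 2 : ℕ) : ℚ_[3]))⁻¹‖ = 1 := by
        rw [show ((0 + 2 : ℕ) : ℚ_[3]) = 2 by norm_num]; exact norm_inv_two₂
      calc ‖coeff (0 + 2) V.formalLog‖ * ‖z‖ ^ (0 + 2) ≤ 1 * ‖z‖ ^ (0 + 2) := by gcongr; exact hc.trans h2.le
        _ = ‖z‖ ^ 2 := by ring
    · -- `n + 2 = 3`
      have h3 : ‖(((1 + 2 : ℕ) : ℚ_[3]))⁻¹‖ = 3 := by
        rw [show ((1 + 2 : ℕ) : ℚ_[3]) = ((3 : ℕ) : ℚ_[3]) by norm_num, norm_inv, Padic.norm_p]; norm_num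
      calc ‖coeff (1 + 2) V.formalLog‖ * ‖z‖ ^ (1 + 2) ≤ 3 * ‖z‖ ^ (1 + 2) := by gcongr; exact hc.trans h3.le
        _ = (3 * ‖z‖) * ‖z‖ ^ 2 := by ring
        _ ≤ 1 * ‖z‖ ^ 2 := by gcongr; linarith
        _ = ‖z‖ ^ 2 := one_mul _
  · -- `m = n + 2 ≥ 4`: `‖1/m‖ ≤ m ≤ 9^{m-2}` and `‖z‖^{m-2} ≤ 9^{-(m-2)}`
    obtain ⟨k, rfl⟩ : ∃ k, n = k + 2 := ⟨n - 2, by omega⟩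
    have hm : ‖(((k + 2 + 2 : ℕ) : ℚ_[3]))⁻¹‖ ≤ ((k + 2 + 2 : ℕ) : ℝ) := padic_norm_inv_natCast_le _
    have hpow : ((k + 2 + 2 : ℕ) : ℝ) ≤ (9 : ℝ) ^ (k + 2) := by
      have := add_four_le_nine_pow k
      rw [show k + 2 + 2 = k + 4 by ring]; exact_mod_cast this
    have hzk : ‖z‖ ^ (k + 2) ≤ (1 / 9 : ℝ) ^ (k + 2) := by gcongr
    calc ‖coeff (k + 2 + 2) V.formalLog‖ * ‖z‖ ^ (k + 2 + 2)
        ≤ (9 : ℝ) ^ (k + 2) * ‖z‖ ^ (k + 2 + 2) := by gcongr; exact hc.trans (hm.trans hpow)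
      _ = ((9 : ℝ) ^ (k + 2) * ‖z‖ ^ (k + 2)) * ‖z‖ ^ 2 := by ring
      _ ≤ ((9 : ℝ) ^ (k + 2) * (1 / 9 : ℝ) ^ (k + 2)) * ‖z‖ ^ 2 := by gcongr
      _ = ‖z‖ ^ 2 := by rw [← mul_pow]; norm_num

/-- **`log_Ŵ(z) = z + O(‖z‖²)` on `‖z‖₃ ≤ 3⁻²`** for a `3`-integral equation over `ℚ₃`:
`‖padicFormalLog W z − z‖₃ ≤ ‖z‖²`. [Silverman AEC IV.5.5, IV.6.4] [cite: SilvermanAEC2009, IV.6.4] -/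
theorem norm_padicFormalLog_sub_self_le {z : ℚ_[3]} (hz : ‖z‖ ≤ 1 / 9) : ‖V.padicFormalLog z - z‖ ≤ ‖z‖ ^ 2 := by
  have hs := V.summable_formalLog_of_isIntegral z (hz.trans_lt (by norm_num))
  have hsplit := hs.sum_add_tsum_nat_add 2
  have h0 : coeff 0 V.formalLog = 0 := by rw [coeff_zero_eq_constantCoeff]; exact V.constantCoeff_formalLog
  have htwo : ∑ i ∈ Finset.range 2, coeff i V.formalLog * z ^ i = z := by
    simp only [Finset.sum_range_succ, Finset.sum_range_zero, h0, V.coeff_one_formalLog]; ring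
  rw [WeierstrassCurve.padicFormalLog, ← hsplit, htwo, add_sub_cancel_left]
  exact IsUltrametricDist.norm_tsum_le_of_forall_le_of_nonneg (sq_nonneg _) fun n ↦
    norm_formalLog_term_le_sq V hz n

end Padic

/-! ### §2 The `cosh` series to first order: `‖ch(w) − 1 − w/2‖ ≤ 3‖w‖²` on `‖w‖ ≤ 3⁻⁴` -/

/-- **`‖ch(w) − 1 − w/2‖₃ ≤ 3‖w‖²` for `‖w‖₃ ≤ 3⁻⁴`**: the quadratic term has norm `‖w‖²·‖1/24‖ = 3‖w‖²`, and every
later term `‖wⁿ/(2n)!‖ ≤ 3ⁿ‖w‖ⁿ ≤ 3‖w‖²` (Legendre). [folklore] -/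
theorem norm_coshOfSq_sub_one_sub_half_le {w : ℚ_[3]} (hw : ‖w‖ ≤ 1 / 81) :
    ‖coshOfSq w - 1 - w / 2‖ ≤ 3 * ‖w‖ ^ 2 := by
  have hw9 : ‖w‖ ≤ 1 / 9 := hw.trans (by norm_num)
  have hs := summable_coshOfSq_term hw9
  have hsplit := hs.sum_add_tsum_nat_add 2
  have hdef : coshOfSq w = ∑' n : ℕ, w ^ n / (((2 * n).factorial : ℕ) : ℚ_[3]) := by rw [coshOfSq]
  rw [hdef, ← hsplit]
  simp only [Finset.sum_range_succ, Finset.sum_range_zero, zero_add, pow_zero, Nat.mul_zero, Nat.factorial_zero,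
    Nat.cast_one, div_one, pow_one]
  have h2 : (((2 * 1).factorial : ℕ) : ℚ_[3]) = 2 := by norm_num [Nat.factorial]
  rw [h2]
  have hring : 1 + w / 2 + ∑' n : ℕ, w ^ (n + 2) / (((2 * (n + 2)).factorial : ℕ) : ℚ_[3]) - 1 - w / 2 =
      ∑' n : ℕ, w ^ (n + 2) / (((2 * (n + 2)).factorial : ℕ) : ℚ_[3]) := by ring
  rw [hring]
  refine IsUltrametricDist.norm_tsum_le_of_forall_le_of_nonneg (by positivity) fun n ↦ ?_
  rw [div_eq_mul_inv, norm_mul, norm_pow]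
  cases n with
  | zero =>
    -- the quadratic term: `‖1/24‖ = 3`
    have hf : (2 * (0 + 2)).factorial = 24 := by decide
    have h8 : ‖(8 : ℚ_[3])⁻¹‖ = 1 := by
      rw [norm_inv, show (8 : ℚ_[3]) = ((8 : ℤ) : ℚ_[3]) by norm_cast, norm_intCast_eq_one_of_not_dvd (by decide),
        inv_one]
    have h3 : ‖(3 : ℚ_[3])⁻¹‖ = 3 := by
      rw [norm_inv, show (3 : ℚ_[3]) = ((3 : ℕ) : ℚ_[3]) by norm_cast, Padic.norm_p]; norm_num
    have h24 : ‖(((24 : ℕ) : ℚ_[3]))⁻¹‖ = 3 := by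
      rw [show ((24 : ℕ) : ℚ_[3]) = 8 * 3 by norm_num, mul_inv, norm_mul, h8, h3, one_mul]
    rw [hf, h24, zero_add, mul_comm]
  | succ k =>
    -- later terms: `3^{k+3} ‖w‖^{k+3} ≤ 3‖w‖²`
    have hfac := norm_inv_factorial_le' (k + 1 + 2)
    calc ‖w‖ ^ (k + 1 + 2) * ‖((((2 * (k + 1 + 2)).factorial : ℕ) : ℚ_[3]))⁻¹‖
        ≤ ‖w‖ ^ (k + 1 + 2) * (3 : ℝ) ^ (k + 1 + 2) := by gcongr
      _ = (3 * ‖w‖ ^ 2) * ((3 * ‖w‖) ^ k * (9 * ‖w‖)) := by ring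
      _ ≤ (3 * ‖w‖ ^ 2) * ((3 * (1 / 81)) ^ k * (9 * (1 / 81))) := by gcongr
      _ ≤ (3 * ‖w‖ ^ 2) * 1 := by
          gcongr
          calc (3 * (1 / 81) : ℝ) ^ k * (9 * (1 / 81)) ≤ 1 ^ k * (9 * (1 / 81)) := by
                gcongr; norm_num
            _ ≤ 1 := by norm_num
      _ = 3 * ‖w‖ ^ 2 := mul_one _

/-! ### §3 The Iwasawa logarithm at valuation `2K` to first order -/

/-- **`‖Y − 3^{2K}U‖₃ ≤ 3^{−2K−2}`, `‖U‖ = 1`, `‖U² − 1‖ ≤ 3⁻¹ ⇒ ‖log₃ Y − (U² − 1)/2‖₃ ≤ 3⁻²`** (`log₃ Y = 2⁻¹·L((Y·3^{−2K})²)`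
by `padicLog_of_ne_zero` at `ord₃ Y = 2K`; `t := Y·3^{−2K}` has `‖t − U‖ ≤ 3⁻²`, `‖1 − t²‖ ≤ 3⁻¹`, and
`‖L(t²) − (t² − 1)‖ ≤ ‖1 − t²‖²`, `norm_padicLogSeries_add_le`). [cite: Iwasawa1972PadicL, §4.4] -/
theorem norm_padicLog_sub_le_of_norm_sub_le_deep {Y U : ℚ_[3]} (K : ℕ) (hU : ‖U‖ = 1) (hU2 : ‖U ^ 2 - 1‖ ≤ 1 / 3)
    (hY : ‖Y - (3 : ℚ_[3]) ^ (2 * K) * U‖ ≤ ‖(3 : ℚ_[3]) ^ (2 * K)‖ / 9) :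
    ‖padicLog 3 Y - (2 : ℚ_[3])⁻¹ * (U ^ 2 - 1)‖ ≤ 1 / 9 := by
  set P : ℚ_[3] := (3 : ℚ_[3]) ^ (2 * K) with hP
  have hPn : ‖P‖ = ((3 : ℝ) ^ (2 * K))⁻¹ := by
    rw [hP, norm_pow, show (3 : ℚ_[3]) = ((3 : ℕ) : ℚ_[3]) by norm_cast, Padic.norm_p]; simp
  have hPpos : 0 < ‖P‖ := by rw [hPn]; positivity
  have hPU : ‖P * U‖ = ‖P‖ := by rw [norm_mul, hU, mul_one]
  have hYn : ‖Y‖ = ‖P‖ := by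
    rw [← hPU]
    refine Padic.norm_eq_of_norm_sub_lt_right (hY.trans_lt ?_)
    rw [hPU]; linarith
  have hY0 : Y ≠ 0 := by intro h; rw [h, norm_zero] at hYn; exact hPpos.ne hYn
  have hv : Y.valuation = ((2 * K : ℕ) : ℤ) := by
    refine valuation_eq_of_norm_eq hY0 ?_
    rw [hYn, hPn, zpow_neg, zpow_natCast]; norm_num
  have h31 : ((3 : ℚ_[3]) - 1) = 2 := by norm_num
  have hlog : padicLog 3 Y = (2 : ℚ_[3])⁻¹ * padicLogSeries 3 ((Y * (3 : ℚ_[3]) ^ (-((2 * K : ℕ) : ℤ))) ^ 2) := by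
    rw [padicLog_of_ne_zero hY0, hv]; push_cast; rw [h31]
  rw [hlog]
  set t : ℚ_[3] := Y * (3 : ℚ_[3]) ^ (-((2 * K : ℕ) : ℤ)) with ht
  have hinv : (3 : ℚ_[3]) ^ (-((2 * K : ℕ) : ℤ)) = P⁻¹ := by rw [zpow_neg, zpow_natCast]
  have hP0 : P ≠ 0 := norm_pos_iff.mp hPpos
  have htu : t - U = (Y - P * U) * P⁻¹ := by rw [ht, hinv]; field_simp
  have htun : ‖t - U‖ ≤ 1 / 9 := by
    rw [htu, norm_mul, norm_inv]
    calc ‖Y - P * U‖ * ‖P‖⁻¹ ≤ ‖P‖ / 9 * ‖P‖⁻¹ := by gcongr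
      _ = 1 / 9 := by field_simp
  have htu1 : ‖t + U‖ ≤ 1 := by
    have : t + U = (t - U) + 2 * U := by ring
    rw [this]; refine (IsUltrametricDist.norm_add_le_max _ _).trans (max_le (htun.trans (by norm_num)) ?_)
    rw [norm_mul, hU, mul_one, show (2 : ℚ_[3]) = ((2 : ℤ) : ℚ_[3]) by norm_cast]; exact Padic.norm_int_le_one _
  have ht2 : ‖t ^ 2 - U ^ 2‖ ≤ 1 / 9 := by
    have : t ^ 2 - U ^ 2 = (t - U) * (t + U) := by ring
    rw [this, norm_mul]
    calc ‖t - U‖ * ‖t + U‖ ≤ 1 / 9 * 1 := by gcongr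
      _ = 1 / 9 := mul_one _
  have h1t : ‖1 - t ^ 2‖ ≤ 1 / 3 := by
    have : 1 - t ^ 2 = -(t ^ 2 - U ^ 2) + -(U ^ 2 - 1) := by ring
    rw [this]
    refine (IsUltrametricDist.norm_add_le_max _ _).trans (max_le ?_ ?_)
    · rw [norm_neg]; exact ht2.trans (by norm_num)
    · rw [norm_neg]; exact hU2
  have h1t' : ‖1 - t ^ 2‖ < 1 := h1t.trans_lt (by norm_num)
  have hL := norm_padicLogSeries_add_le (p := 3) h1t'
  rw [norm_inv_two₂, mul_one] at hL
  have hsplit : (2 : ℚ_[3])⁻¹ * padicLogSeries 3 (t ^ 2) - (2 : ℚ_[3])⁻¹ * (U ^ 2 - 1) =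
      (2 : ℚ_[3])⁻¹ * ((padicLogSeries 3 (t ^ 2) + (1 - t ^ 2)) + (t ^ 2 - U ^ 2)) := by ring
  rw [hsplit, norm_mul, norm_inv_two₂, one_mul]
  refine (IsUltrametricDist.norm_add_le_max _ _).trans (max_le ?_ ht2)
  refine hL.trans ?_
  calc ‖1 - t ^ 2‖ ^ 2 ≤ (1 / 3) ^ 2 := by gcongr
    _ = 1 / 9 := by norm_num

/-! ### §4 Assembly at depth `K ≥ 2`: `C²σ² ≡ z²`, `h ≡ e'⁴(b⁴ − a⁴)/(2b⁴) (mod 9)` -/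

/-- **The deep REG3CERT kernel certificate (`v₃(e(Q)) = K ≥ 2`).** Let `W/ℚ` be globally minimal with `c₄, c₆` (read
in `ℚ₃`) equal to the given integers, `3 ∤ c₆`, `9 ∣ c₄ + γc₆`, `3 ∤ γ` (so `‖C²‖ = 1`); let
`(x, y) = (a/e², b/e³)` with `e = 3^K e'`, `K ≥ 2`, `3 ∤ e'`, `3 ∤ b`, `gcd(a, e) = 1`. If **`9 ∤ b⁴ − a⁴`**, then for
EVERY `q ∈ ℚ₃` with `‖q‖ < 1`, `heightFourOneCoord W 3 q x y ≠ 0`: with `z = −ae/b` (`‖z‖ = 3⁻ᴷ ≤ 3⁻²`) one has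
`log_Ŵ(z) ≡ z`, `ch(w) − 1 ≡ w/2`, `Π ≡ 1`, hence `C²σ² ≡ log_Ŵ(z)² ≡ z² = 3^{2K}(ae'/b)²` to relative precision `3⁻²`
(§§1–2; the scale `C²` cancels), and the two Iwasawa logarithms (§3) give `h ≡ ½(e'⁴ − 1) − ½((ae'/b)⁴ − 1) =
e'⁴(b⁴ − a⁴)/(2b⁴) (mod 9)`. [cite: SteinWuthrich2013, §4.2] [cite: Iwasawa1972PadicL, §4.4] -/
theorem heightFourOneCoord_ne_zero_of_deepCert (W : WeierstrassCurve ℚ) [W.IsGloballyMinimal]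
    {c4 c6 γ : ℤ} (hc4 : (W.baseChange ℚ_[3]).c₄ = c4) (hc6 : (W.baseChange ℚ_[3]).c₆ = c6) (h3c6 : ¬ (3 : ℤ) ∣ c6)
    (hγ : (9 : ℤ) ∣ c4 + γ * c6) (h3γ : ¬ (3 : ℤ) ∣ γ)
    {a b : ℤ} {e' K : ℕ} (hK : 2 ≤ K) (h3e' : ¬ (3 : ℤ) ∣ e') (h3b : ¬ (3 : ℤ) ∣ b)
    (hcop : Nat.Coprime a.natAbs (3 ^ K * e'))
    {x y : ℚ} (hx : x = a / ((3 ^ K * e' : ℕ) : ℚ) ^ 2) (hy : y = b / ((3 ^ K * e' : ℕ) : ℚ) ^ 3)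
    (hcert : ¬ (9 : ℤ) ∣ b ^ 4 - a ^ 4) {q : ℚ_[3]} (hq : ‖q‖ < 1) :
    heightFourOneCoord W 3 q x y ≠ 0 := by
  have hq3 : ‖q‖ ≤ 1 / 3 := norm_le_third_of_norm_lt_one hq
  have he'0 : e' ≠ 0 := by rintro rfl; exact h3e' (by simp)
  have he0 : (3 ^ K * e' : ℕ) ≠ 0 := by positivity
  have hb0 : b ≠ 0 := by rintro rfl; exact h3b (dvd_zero 3)
  -- `3 ∤ a` from `gcd(a, 3^K e') = 1`
  have h3a : ¬ (3 : ℤ) ∣ a := by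
    intro h
    have h1 : 3 ∣ a.natAbs := Int.natCast_dvd.mp h
    have h3 : 3 ∣ Nat.gcd a.natAbs (3 ^ K * e') := Nat.dvd_gcd h1 (dvd_mul_of_dvd_left (dvd_pow_self 3 (by omega)) e')
    rw [hcop] at h3; omega
  have han : ‖(a : ℚ_[3])‖ = 1 := norm_intCast_eq_one_of_not_dvd h3a
  have hbn : ‖(b : ℚ_[3])‖ = 1 := norm_intCast_eq_one_of_not_dvd h3b
  have he'n : ‖(e' : ℚ_[3])‖ = 1 := by
    have := norm_intCast_eq_one_of_not_dvd h3e'; push_cast at this; exact this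
  have hb0' : (b : ℚ_[3]) ≠ 0 := by exact_mod_cast hb0
  set P : ℚ_[3] := (3 : ℚ_[3]) ^ (2 * K) with hP
  have hPn : ‖P‖ = ((1 / 3 : ℝ) ^ K) ^ 2 := by
    rw [hP, norm_pow, show (3 : ℚ_[3]) = ((3 : ℕ) : ℚ_[3]) by norm_cast, Padic.norm_p, mul_comm 2 K, pow_mul]
    norm_num
  -- the parameter `z = −ae/b` and `ρ = ‖z‖`
  set z : ℚ_[3] := -((a : ℚ_[3]) * ((3 ^ K * e' : ℕ) : ℚ_[3])) / (b : ℚ_[3]) with hz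
  set U : ℚ_[3] := ((a : ℚ_[3]) * (e' : ℚ_[3]) / (b : ℚ_[3])) ^ 2 with hU
  have hUn : ‖U‖ = 1 := by rw [hU, norm_pow, norm_div, norm_mul, han, he'n, hbn]; norm_num
  have hz2 : z ^ 2 = P * U := by rw [hz, hU, hP]; push_cast; field_simp; ring
  have hρ : ‖z‖ = (1 / 3 : ℝ) ^ K := by
    rw [hz, norm_div, norm_neg, norm_mul, han, hbn, one_mul, div_one]
    push_cast
    rw [norm_mul, norm_pow, he'n, mul_one, show (3 : ℚ_[3]) = ((3 : ℕ) : ℚ_[3]) by norm_cast, Padic.norm_p]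
    norm_num
  set ρ : ℝ := ‖z‖ with hρdef
  have hρ9 : ρ ≤ 1 / 9 := by
    rw [hρ]; calc (1 / 3 : ℝ) ^ K ≤ (1 / 3) ^ 2 := pow_le_pow_of_le_one (by norm_num) (by norm_num) hK
      _ = 1 / 9 := by norm_num
  have hρpos : 0 < ρ := by rw [hρ]; positivity
  have hρ2 : ρ ^ 2 = ‖P‖ := by rw [hρ, hPn]
  set V := W.baseChange ℚ_[3] with hV
  set L := V.padicFormalLog z with hLdef
  have hLz : ‖L - z‖ ≤ ρ ^ 2 := norm_padicFormalLog_sub_self_le V hρ9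
  have hρsq : ρ ^ 2 ≤ ρ * (1 / 9) := by rw [sq]; exact mul_le_mul_of_nonneg_left hρ9 hρpos.le
  have hρ4 : ρ ^ 2 * ρ ^ 2 ≤ ρ ^ 2 * (1 / 81) := by
    refine mul_le_mul_of_nonneg_left ?_ (sq_nonneg ρ)
    calc ρ ^ 2 ≤ (1 / 9) ^ 2 := by gcongr
      _ = 1 / 81 := by norm_num
  have hρ2pos : 0 < ρ ^ 2 := by positivity
  have hLn : ‖L‖ = ρ := by
    refine Padic.norm_eq_of_norm_sub_lt_right (hLz.trans_lt ?_)
    show ρ ^ 2 < ρ; linarith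
  have hC := norm_uniformisationScaleSq_sub_le W hc4 hc6 h3c6 hγ hq3
  set C2 := uniformisationScaleSq W 3 q with hC2
  have hγn : ‖(γ : ℚ_[3])‖ = 1 := norm_intCast_eq_one_of_not_dvd h3γ
  have hCn : ‖C2‖ = 1 := by
    rw [← hγn]; exact Padic.norm_eq_of_norm_sub_lt_right (hC.trans_lt (by rw [hγn]; norm_num))
  have hC0 : C2 ≠ 0 := by intro h; rw [h, norm_zero] at hCn; exact zero_ne_one hCn
  have hwdef : logUnitParamSq W 3 q x y = L ^ 2 / C2 := by
    rw [logUnitParamSq, hx, hy, neg_div_cast_eq hb0 he0]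
  set w := L ^ 2 / C2 with hw
  have hwn : ‖w‖ = ρ ^ 2 := by rw [hw, norm_div, norm_pow, hLn, hCn, div_one]
  have hw81 : ‖w‖ ≤ 1 / 81 := by
    rw [hwn]; calc ρ ^ 2 ≤ (1 / 9) ^ 2 := by gcongr
      _ = 1 / 81 := by norm_num
  have hCw : C2 * w = L ^ 2 := by rw [hw]; field_simp
  set c := coshOfSq w with hc
  have hc1 : ‖(c - 1) - w / 2‖ ≤ 3 * ‖w‖ ^ 2 := by
    have := norm_coshOfSq_sub_one_sub_half_le hw81; rwa [hc]
  have h2n : ‖(2 : ℚ_[3])‖ = 1 := by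
    rw [show (2 : ℚ_[3]) = ((2 : ℤ) : ℚ_[3]) by norm_cast]; exact norm_intCast_eq_one_of_not_dvd (by decide)
  have hw2 : ‖w / 2‖ = ρ ^ 2 := by rw [norm_div, h2n, div_one, hwn]
  have hc1n : ‖c - 1‖ = ρ ^ 2 := by
    rw [← hw2]
    refine Padic.norm_eq_of_norm_sub_lt_right (hc1.trans_lt ?_)
    rw [hw2, hwn]
    have : (ρ ^ 2) ^ 2 = ρ ^ 2 * ρ ^ 2 := by ring
    rw [this]; linarith
  have hcn : ‖c‖ ≤ 1 := by
    have : c = (c - 1) + 1 := by ring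
    rw [this]
    refine (IsUltrametricDist.norm_add_le_max _ _).trans (max_le ?_ (by rw [norm_one]))
    rw [hc1n]; linarith
  have hPr := norm_tprod_tateSigmaSq_factor_sub_one_le hq hcn
  set Pr := ∏' n : ℕ, (1 - 2 * q ^ (n + 1) * c + q ^ (2 * (n + 1))) ^ 2 / (1 - q ^ (n + 1)) ^ 4 with hPrdef
  have hσ : tateSigmaSq q c = 2 * (c - 1) * Pr := by rw [tateSigmaSq]
  -- `Y = C²σ² ≡ z² = P·U`
  have hY : ‖C2 * tateSigmaSq q c - P * U‖ ≤ ‖P‖ / 9 := by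
    rw [hσ, ← hz2]
    have hsplit : C2 * (2 * (c - 1) * Pr) - z ^ 2 =
        2 * C2 * (c - 1) * (Pr - 1) + 2 * C2 * ((c - 1) - w / 2) + (C2 * w - L ^ 2) + (L ^ 2 - z ^ 2) := by ring
    rw [hsplit, hCw, sub_self, add_zero]
    have hb1 : ‖2 * C2 * (c - 1) * (Pr - 1)‖ ≤ ρ ^ 2 / 9 := by
      rw [norm_mul, norm_mul, norm_mul, h2n, hCn, hc1n, one_mul, one_mul]
      calc ρ ^ 2 * ‖Pr - 1‖ ≤ ρ ^ 2 * (‖q‖ * ‖c - 1‖) := by gcongr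
        _ ≤ ρ ^ 2 * (1 / 3 * ρ ^ 2) := by rw [hc1n]; gcongr
        _ = (ρ ^ 2 * ρ ^ 2) / 3 := by ring
        _ ≤ (ρ ^ 2 * (1 / 81)) / 3 := by gcongr
        _ ≤ ρ ^ 2 / 9 := by linarith
    have hb2 : ‖2 * C2 * ((c - 1) - w / 2)‖ ≤ ρ ^ 2 / 9 := by
      rw [norm_mul, norm_mul, h2n, hCn, one_mul, one_mul]
      refine hc1.trans ?_
      rw [hwn, show (ρ ^ 2) ^ 2 = ρ ^ 2 * ρ ^ 2 by ring]; linarith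
    have hb3 : ‖L ^ 2 - z ^ 2‖ ≤ ρ ^ 2 / 9 := by
      have : L ^ 2 - z ^ 2 = (L - z) * (L + z) := by ring
      rw [this, norm_mul]
      have hLz' : ‖L + z‖ ≤ ρ := (IsUltrametricDist.norm_add_le_max _ _).trans (max_le hLn.le le_rfl)
      calc ‖L - z‖ * ‖L + z‖ ≤ ρ ^ 2 * ρ := by gcongr
        _ ≤ ρ ^ 2 * (1 / 9) := mul_le_mul_of_nonneg_left hρ9 (sq_nonneg ρ)
        _ = ρ ^ 2 / 9 := by ring
    rw [← hρ2]
    refine (IsUltrametricDist.norm_add_le_max _ _).trans (max_le ?_ hb3)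
    exact (IsUltrametricDist.norm_add_le_max _ _).trans (max_le hb1 hb2)
  have hU2 : ‖U ^ 2 - 1‖ ≤ 1 / 3 := by
    have hid : U ^ 2 - 1 = ((((a * e') ^ 4 - b ^ 4 : ℤ)) : ℚ_[3]) / (b : ℚ_[3]) ^ 4 := by
      rw [hU]; push_cast; field_simp
    have hdvd : (3 : ℤ) ∣ (a * e') ^ 4 - b ^ 4 := by
      have h1 := three_dvd_pow_four_sub_one (n := a * e') (fun h => by
        rcases (Int.Prime.dvd_mul' (by norm_num) h) with h | h
        · exact h3a h
        · exact h3e' h)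
      have h2 := three_dvd_pow_four_sub_one h3b
      have : (a * e') ^ 4 - b ^ 4 = ((a * e') ^ 4 - 1) - (b ^ 4 - 1) := by ring
      rw [this]; exact dvd_sub h1 h2
    rw [hid, norm_div, norm_pow, hbn, one_pow, div_one]
    exact (norm_intCast_le_of_pow_dvd (k := 1) (by rw [pow_one]; exact hdvd)).trans (by norm_num)
  have hlogY := norm_padicLog_sub_le_of_norm_sub_le_deep K hUn hU2 hY
  have hden : x.den = (3 ^ K * e') ^ 2 := by
    have hpos : (0 : ℤ) < ((3 ^ K * e' : ℕ) : ℤ) ^ 2 := by positivity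
    have hcop2 : Nat.Coprime a.natAbs ((((3 ^ K * e' : ℕ) : ℤ) ^ 2).natAbs) := by
      rw [Int.natAbs_pow, Int.natAbs_natCast]; exact hcop.pow_right 2
    have h := Rat.den_div_eq_of_coprime hpos hcop2
    have hx' : x = ((a : ℤ) : ℚ) / ((((3 ^ K * e' : ℕ) : ℤ) ^ 2 : ℤ) : ℚ) := by rw [hx]; push_cast; ring
    rw [← hx'] at h
    exact_mod_cast h
  set Ud : ℚ_[3] := (e' : ℚ_[3]) ^ 2 with hUd
  have hUdn : ‖Ud‖ = 1 := by rw [hUd, norm_pow, he'n, one_pow]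
  have hUd2 : ‖Ud ^ 2 - 1‖ ≤ 1 / 3 := by
    rw [show Ud ^ 2 - 1 = ((((e' : ℤ) ^ 4 - 1 : ℤ)) : ℚ_[3]) by rw [hUd]; push_cast; ring]
    exact (norm_intCast_le_of_pow_dvd (k := 1) (by simpa using three_dvd_pow_four_sub_one h3e')).trans (by norm_num)
  have hYd : ‖(((x.den : ℚ)) : ℚ_[3]) - P * Ud‖ ≤ ‖P‖ / 9 := by
    have : (((x.den : ℚ)) : ℚ_[3]) = P * Ud := by rw [hden, hP, hUd]; push_cast; ring
    rw [this, sub_self, norm_zero]; positivity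
  have hlogd := norm_padicLog_sub_le_of_norm_sub_le_deep K hUdn hUd2 hYd
  intro h0
  rw [heightFourOneCoord, hwdef] at h0
  have heq : padicLog 3 (((x.den : ℚ)) : ℚ_[3]) = padicLog 3 (C2 * tateSigmaSq q c) := sub_eq_zero.mp h0
  rw [heq] at hlogd
  have hdiff : ‖(2 : ℚ_[3])⁻¹ * (Ud ^ 2 - 1) - (2 : ℚ_[3])⁻¹ * (U ^ 2 - 1)‖ ≤ 1 / 9 := by
    have : (2 : ℚ_[3])⁻¹ * (Ud ^ 2 - 1) - (2 : ℚ_[3])⁻¹ * (U ^ 2 - 1) =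
        (padicLog 3 (C2 * tateSigmaSq q c) - (2 : ℚ_[3])⁻¹ * (U ^ 2 - 1)) -
        (padicLog 3 (C2 * tateSigmaSq q c) - (2 : ℚ_[3])⁻¹ * (Ud ^ 2 - 1)) := by ring
    rw [this]; exact (norm_sub_le_max₂ _ _).trans (max_le hlogY hlogd)
  have hid : (2 : ℚ_[3])⁻¹ * (Ud ^ 2 - 1) - (2 : ℚ_[3])⁻¹ * (U ^ 2 - 1) =
      (2 : ℚ_[3])⁻¹ * (e' : ℚ_[3]) ^ 4 * ((((b ^ 4 - a ^ 4 : ℤ)) : ℚ_[3]) / (b : ℚ_[3]) ^ 4) := by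
    rw [hUd, hU]; push_cast; field_simp; ring
  rw [hid, norm_mul, norm_mul, norm_inv_two₂, norm_pow, he'n, one_pow, one_mul, one_mul, norm_div, norm_pow, hbn,
    one_pow, div_one] at hdiff
  have h9 : ((3 : ℕ) : ℤ) ^ 2 ∣ b ^ 4 - a ^ 4 :=
    (Padic.norm_int_le_pow_iff_dvd (p := 3) _ 2).mp (hdiff.trans (by norm_num))
  exact hcert (by simpa using h9)

end Summit.BirchSwinnertonDyer.Rank1Residual.X11b.RegMult.KernelCert
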